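import Summits.QuantumFields.YangMills.Theorems.SourcedPressureJensenSourcedPressureIncrementGaussWindowLemmas
import HarnessLib

/-!
# `SourcedPressureIncrement` (stmt-QuantumFields-22517): the Gaussian sourced increment to SECOND ORDER in the WINDOW
# `h·|B| ≲ 1` — no cluster expansion

With `γ = curvatureGaussianField 4 D`, `A_x = (λ/2)|Y(p₁₂ x)|² − m`, `m = (λ/2)·D·C(0) = λD/4`, `H_B = Σ_{x∈B} A_x A_{x+ne₀}`
(integrand of the ideator's `gaussIncrement`), the exact first cumulant `E_γ H_B = |B|·(λ²D/2)·C(n)²`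
(`gauss_firstCumulant_sum`) and the volume-uniform stability of file `…UniformStability` give, by the elementary
second-order exponential inequality `e^y ≤ 1 + y + (y²/2)e^{y₊}` and `log z ≤ z − 1`:

* `gauss_increment_window` — there are `K` and `h₁ > 0` depending ONLY on `(D, λ)` such that for every separation `n`, every
  finite `B ⊂ ℤ⁴` and every `0 ≤ h` with `h·(|B|+1) ≤ h₁`:
  `log E_γ exp(−h H_B) ≤ −h·|B|·(λ²D/2)·C(n)² + K·h²·(|B|+1)⁴`.

So in the WINDOW `h|B| ≤ h₁` (which is the regime of the route: `h = β^{−κ/2}`, cells of side `β^θ`, `κ/2 > 4θ`) the Gaussian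
sourced increment equals its first cumulant up to an explicit `O(h²·poly|B|)` — second order WITHOUT any tilted-measure /
cluster-expansion input; the polynomial `(|B|+1)⁴` is crude (fourth moments are taken from exponential moments,
`z⁴ ≤ 24 s⁻⁴ e^{sz}`) and improves to `|B|` once the second cumulant `Var_γ H_B ≤ M₂|B|` (w2's Wick files) is used.  The generic
lemmas live in the companion file `…GaussWindowLemmas`.

Everything is proved; no definition, no named fact.  RECORD-label rung support; the Yang–Mills mass gap is NOT proved by anything
here. [folklore]
-/

noncomputable section

open MeasureTheory ProbabilityTheory Real Finset
open Literature.Probability.LatticeModels Literature.MathematicalPhysics.QuantumLattice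
open Literature.MathematicalPhysics.QuantumFieldTheory

namespace Summit.QuantumFields.YangMills.Cruxes.SourcedPressureIncrement.Birth

/-! ### The Gaussian sourced increment to second order in the window -/

section Window

set_option maxHeartbeats 800000 in
-- one long bookkeeping proof (many small rewrites on a large integrand); the budget is for the whole declaration
/-- **The Gaussian sourced increment to second order, in the window `h·(|B|+1) ≤ h₁`.**  For every colour number `D` and
scale `λ ≥ 0` there are `K` and `h₁ > 0` (depending only on `D, λ`) such that for every separation `n`, every finite
`B ⊂ ℤ⁴` and every `0 ≤ h` with `h·(|B|+1) ≤ h₁`: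
`log E_γ exp(−h Σ_{x∈B} A_x A_{x+ne₀}) ≤ −h·|B|·(λ²D/2)·C(n)² + K·h²·(|B|+1)⁴`
(integrand of `gaussIncrement` verbatim).  Mechanism: `log E e^Y ≤ EY + E[(Y²/2)e^{Y₊}]` with `Y = −hH_B`, the exact first
cumulant, `Y₊ ≤ h m λ Σ_I ω²`, `|H_B| ≤ ½(λΣ_I ω² + 2m|B|)²`, `z⁴ ≤ 24 s⁻⁴e^{sz}` at `s ≍ 1/(|B|+1)`, and the volume-UNIFORM
exponential moment `E exp(tΣ_I ω²) ≤ e^{t|I|}` (`t ≤ 1/4`) of `integral_exp_mul_sum_sq_curvature_parallel_le`. [folklore] -/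
theorem gauss_increment_window (D : ℕ) {lam : ℝ} (hlam : 0 ≤ lam) :
    ∃ K h₁ : ℝ, 0 < h₁ ∧ ∀ (n : ℕ) (B : Finset (Site 4)) (h : ℝ), 0 ≤ h → h * (B.card + 1) ≤ h₁ →
      Real.log (∫ Y, Real.exp (-h * ∑ x ∈ B,
        (lam / 2 * (∑ a : Fin D, (Y (plaquette12 (d := 4) (by norm_num) x) a) ^ 2) -
            lam / 2 * D * curvaturePlaquetteCorr (d := 4) (by norm_num) 0) *
          (lam / 2 * (∑ a : Fin D, (Y (plaquette12 (d := 4) (by norm_num) (x + Pi.single (0 : Fin 4) (n : ℤ))) a) ^ 2) -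
            lam / 2 * D * curvaturePlaquetteCorr (d := 4) (by norm_num) 0))
        ∂curvatureGaussianField (d := 4) D) ≤
      -h * ((B.card : ℝ) * (lam ^ 2 * D / 2 * (curvaturePlaquetteCorr (d := 4) (by norm_num) (n : ℤ)) ^ 2)) +
        K * h ^ 2 * ((B.card : ℝ) + 1) ^ 4 := by
  have hd : 3 ≤ 4 := by norm_num
  have hK := isPosSemidefKernel_curvatureCovKernel hd D
  haveI := isProbabilityMeasure_curvatureGaussianField hd D
  haveI := isProbabilityMeasure_gaussianFieldOfKernel hK
  -- constants
  set m : ℝ := lam / 2 * D * curvaturePlaquetteCorr (d := 4) hd 0 with hm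
  have hC0 : curvaturePlaquetteCorr (d := 4) hd 0 = 1 / 2 := by
    rw [curvaturePlaquetteCorr_zero hd]; norm_num
  have hm' : m = lam * D / 4 := by rw [hm, hC0]; ring
  have hm0 : 0 ≤ m := by rw [hm']; positivity
  -- make `m` opaque: its value (`curvaturePlaquetteCorr` at concrete plaquettes) is expensive to unfold in `whnf`,
  -- and remove every hypothesis mentioning that value (atom comparisons in `linarith`/`positivity` unfold it)
  clear_value m
  have hfc : ∀ (n : ℕ) (B : Finset (Site 4)), ∫ Y, ∑ x ∈ B,
      (lam / 2 * (∑ a : Fin D, (Y (plaquette12 (d := 4) hd x) a) ^ 2) - m) *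
        (lam / 2 * (∑ a : Fin D, (Y (plaquette12 (d := 4) hd (x + Pi.single (0 : Fin 4) (n : ℤ))) a) ^ 2) - m)
      ∂curvatureGaussianField (d := 4) D =
      (B.card : ℝ) * (lam ^ 2 * D / 2 * (curvaturePlaquetteCorr (d := 4) hd (n : ℤ)) ^ 2) := fun n B => by
    rw [hm]; exact gauss_firstCumulant_sum D lam n B
  clear hm hC0
  -- `s₀`: the scale of the auxiliary exponential; `h₁`: the window
  set s₀ : ℝ := 1 / (8 * (lam + 1)) with hs₀
  clear_value s₀
  have hs₀pos : 0 < s₀ := by rw [hs₀]; positivity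
  set h₁ : ℝ := 1 / (8 * (m * lam + 1)) with hh₁
  clear_value h₁
  have hh₁pos : 0 < h₁ := by rw [hh₁]; positivity
  -- the constant
  set K : ℝ := 3 / s₀ ^ 4 * Real.exp (2 * m * s₀ + (D : ℝ) / 2) with hKdef
  clear_value K
  refine ⟨K, h₁, hh₁pos, fun n B h hh hwin => ?_⟩
  -- abbreviations
  set p : Site 4 → ZdPlaquette 4 := plaquette12 (d := 4) hd with hp
  set q : Site 4 → ZdPlaquette 4 := fun x => p (x + Pi.single (0 : Fin 4) (n : ℤ)) with hq
  have hpq : ∀ x : Site 4, p (x + Pi.single (0 : Fin 4) (n : ℤ)) = q x := fun x => by rw [hq]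
  have hfcn := hfc n B
  simp only [hpq] at hfcn ⊢
  set I : Finset (ZdPlaquette 4 × Fin D) := (B.image p ∪ B.image q) ×ˢ (Finset.univ : Finset (Fin D)) with hI
  clear_value p q I
  set N : ℝ := (B.card : ℝ) + 1 with hN
  clear_value N
  have hN1 : 1 ≤ N := by rw [hN]; have : (0 : ℝ) ≤ B.card := Nat.cast_nonneg _; linarith
  have hNpos : 0 < N := by linarith
  have hhN : h * N ≤ h₁ := hwin
  have hh1 : h ≤ h₁ := by nlinarith
  -- the auxiliary scale `s = s₀ / N` and the exponential rate `t = s λ + h m λ ≤ 1/4`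
  set s : ℝ := s₀ / N with hs
  clear_value s
  have hspos : 0 < s := by rw [hs]; positivity
  set c : ℝ := h * (m * lam) with hc
  clear_value c
  have hc0 : 0 ≤ c := by rw [hc]; exact mul_nonneg hh (mul_nonneg hm0 hlam)
  have hc8 : c * N ≤ 1 / 8 := by
    rw [hc]
    have hden : 0 < m * lam + 1 := by positivity
    calc h * (m * lam) * N = (h * N) * (m * lam) := by ring
      _ ≤ h₁ * (m * lam) := mul_le_mul_of_nonneg_right hhN (by positivity)
      _ = (m * lam) / (8 * (m * lam + 1)) := by rw [hh₁]; ring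
      _ ≤ 1 / 8 := by
          rw [div_le_div_iff₀ (by positivity) (by norm_num)]
          nlinarith
  have hc8' : c ≤ 1 / 8 := by nlinarith
  have hsl : s * lam ≤ 1 / 8 / N := by
    rw [hs, hs₀]
    rw [div_mul_eq_mul_div, div_le_div_iff₀ hNpos hNpos]
    have : 1 / (8 * (lam + 1)) * lam ≤ 1 / 8 := by
      rw [div_mul_eq_mul_div, div_le_div_iff₀ (by positivity) (by norm_num)]
      nlinarith
    nlinarith
  have hsl' : s * lam ≤ 1 / 8 := by
    refine hsl.trans ?_
    rw [div_le_iff₀ hNpos]; nlinarith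
  set t : ℝ := s * lam + c with ht
  clear_value t
  have ht0 : 0 ≤ t := by rw [ht]; exact add_nonneg (mul_nonneg hspos.le hlam) hc0
  have ht4 : t ≤ 1 / 4 := by rw [ht]; linarith
  -- the uniform exponential moment at rate `t`
  have hIor : ∀ u ∈ I, u.1.2 = (plaquette12 (d := 4) hd (0 : Site 4)).2 := fun u hu =>
    snd_fst_eq_of_mem_indices D n B u (by simpa [hI, hp, hq] using hu)
  obtain ⟨hintT, hleT⟩ := integral_exp_mul_sum_sq_curvature_parallel_le hd D _ I hIor ht0 ht4
  have hcardI : (I.card : ℝ) ≤ 2 * B.card * D := by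
    have := card_indices_le D n B
    simpa [hI, hp, hq] using this
  -- the source on the uncurried configuration space
  set Hω : (ZdPlaquette 4 × Fin D → ℝ) → ℝ := fun ω => ∑ x ∈ B,
      (lam / 2 * (∑ a : Fin D, ω (p x, a) ^ 2) - m) * (lam / 2 * (∑ a : Fin D, ω (q x, a) ^ 2) - m) with hHω
  clear_value Hω
  set Qω : (ZdPlaquette 4 × Fin D → ℝ) → ℝ := fun ω => ∑ u ∈ I, ω u ^ 2 with hQω
  clear_value Qω
  have hQnn : ∀ ω, 0 ≤ Qω ω := fun ω => by rw [hQω]; exact Finset.sum_nonneg fun u _ => sq_nonneg _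
  -- (a) one-sided domination `−h H ≤ c Q`
  have hsumQ : ∀ ω, ∑ x ∈ B, ((∑ a : Fin D, ω (p x, a) ^ 2) + ∑ a : Fin D, ω (q x, a) ^ 2) ≤ 2 * Qω ω := by
    intro ω
    have hidx := sum_colourSq_le_sum_indices D n B ω
    simpa [hp, hq, hI, hQω] using hidx
  have hdom : ∀ ω, -h * Hω ω ≤ c * Qω ω := by
    intro ω
    have hstep : -Hω ω ≤ m * (lam / 2) * ∑ x ∈ B, ((∑ a : Fin D, ω (p x, a) ^ 2) + ∑ a : Fin D, ω (q x, a) ^ 2) := by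
      rw [hHω, ← Finset.sum_neg_distrib, Finset.mul_sum]
      refine Finset.sum_le_sum fun x _ => ?_
      have hS : 0 ≤ lam / 2 * ∑ a : Fin D, ω (p x, a) ^ 2 :=
        mul_nonneg (by positivity) (Finset.sum_nonneg fun a _ => sq_nonneg _)
      have hS' : 0 ≤ lam / 2 * ∑ a : Fin D, ω (q x, a) ^ 2 :=
        mul_nonneg (by positivity) (Finset.sum_nonneg fun a _ => sq_nonneg _)
      have := neg_centred_mul_centred_le m hS hS'
      nlinarith [this]
    calc -h * Hω ω = h * (-Hω ω) := by ring
      _ ≤ h * (m * (lam / 2) * (2 * Qω ω)) := by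
          refine mul_le_mul_of_nonneg_left (hstep.trans ?_) hh
          exact mul_le_mul_of_nonneg_left (hsumQ ω) (by positivity)
      _ = c * Qω ω := by rw [hc]; ring
  -- (b) two-sided domination `|H| ≤ ½ (λ Q + 2 m |B|)²`
  have habs : ∀ ω, |Hω ω| ≤ (lam * Qω ω + 2 * m * B.card) ^ 2 / 2 := by
    intro ω
    have hSnn : ∀ x : Site 4, 0 ≤ lam / 2 * ∑ a : Fin D, ω (p x, a) ^ 2 := fun x =>
      mul_nonneg (by positivity) (Finset.sum_nonneg fun a _ => sq_nonneg _)
    have hSnn' : ∀ x : Site 4, 0 ≤ lam / 2 * ∑ a : Fin D, ω (q x, a) ^ 2 := fun x =>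
      mul_nonneg (by positivity) (Finset.sum_nonneg fun a _ => sq_nonneg _)
    -- per-site weights
    have hwnn : ∀ x : Site 4, 0 ≤ (lam / 2 * ∑ a : Fin D, ω (p x, a) ^ 2 + m) + (lam / 2 * ∑ a : Fin D, ω (q x, a) ^ 2 + m) :=
      fun x => add_nonneg (add_nonneg (hSnn x) hm0) (add_nonneg (hSnn' x) hm0)
    have hsumw : ∑ x ∈ B, ((lam / 2 * ∑ a : Fin D, ω (p x, a) ^ 2 + m) + (lam / 2 * ∑ a : Fin D, ω (q x, a) ^ 2 + m)) ≤
        lam * Qω ω + 2 * m * B.card := by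
      have : ∑ x ∈ B, ((lam / 2 * ∑ a : Fin D, ω (p x, a) ^ 2 + m) + (lam / 2 * ∑ a : Fin D, ω (q x, a) ^ 2 + m)) =
          lam / 2 * ∑ x ∈ B, ((∑ a : Fin D, ω (p x, a) ^ 2) + ∑ a : Fin D, ω (q x, a) ^ 2) + 2 * m * B.card := by
        simp only [Finset.mul_sum, mul_add, Finset.sum_add_distrib, Finset.sum_const, nsmul_eq_mul]
        ring
      rw [this]
      have h2 : lam / 2 * ∑ x ∈ B, ((∑ a : Fin D, ω (p x, a) ^ 2) + ∑ a : Fin D, ω (q x, a) ^ 2) ≤ lam / 2 * (2 * Qω ω) :=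
        mul_le_mul_of_nonneg_left (hsumQ ω) (by positivity)
      have h3 : lam / 2 * (2 * Qω ω) = lam * Qω ω := by ring
      linarith
    have hsq : ∑ x ∈ B, ((lam / 2 * ∑ a : Fin D, ω (p x, a) ^ 2 + m) +
        (lam / 2 * ∑ a : Fin D, ω (q x, a) ^ 2 + m)) ^ 2 ≤
        (∑ x ∈ B, ((lam / 2 * ∑ a : Fin D, ω (p x, a) ^ 2 + m) +
          (lam / 2 * ∑ a : Fin D, ω (q x, a) ^ 2 + m))) ^ 2 :=
      Finset.sum_sq_le_sq_sum_of_nonneg fun x _ => hwnn x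
    have h0 : 0 ≤ ∑ x ∈ B, ((lam / 2 * ∑ a : Fin D, ω (p x, a) ^ 2 + m) + (lam / 2 * ∑ a : Fin D, ω (q x, a) ^ 2 + m)) :=
      Finset.sum_nonneg fun x _ => hwnn x
    calc |Hω ω| ≤ ∑ x ∈ B, |(lam / 2 * (∑ a : Fin D, ω (p x, a) ^ 2) - m) *
          (lam / 2 * (∑ a : Fin D, ω (q x, a) ^ 2) - m)| := by rw [hHω]; exact Finset.abs_sum_le_sum_abs _ _
      _ ≤ ∑ x ∈ B, ((lam / 2 * ∑ a : Fin D, ω (p x, a) ^ 2 + m) + (lam / 2 * ∑ a : Fin D, ω (q x, a) ^ 2 + m)) ^ 2 / 2 :=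
          Finset.sum_le_sum fun x _ => abs_centred_mul_centred_le (hSnn x) (hSnn' x) hm0
      _ = (∑ x ∈ B, ((lam / 2 * ∑ a : Fin D, ω (p x, a) ^ 2 + m) + (lam / 2 * ∑ a : Fin D, ω (q x, a) ^ 2 + m)) ^ 2) / 2 := by
          rw [Finset.sum_div]
      _ ≤ (∑ x ∈ B, ((lam / 2 * ∑ a : Fin D, ω (p x, a) ^ 2 + m) + (lam / 2 * ∑ a : Fin D, ω (q x, a) ^ 2 + m))) ^ 2 / 2 := by
          gcongr
      _ ≤ (lam * Qω ω + 2 * m * B.card) ^ 2 / 2 := by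
          gcongr
  -- (c) the remainder is dominated by an exponential moment
  set Yω : (ZdPlaquette 4 × Fin D → ℝ) → ℝ := fun ω => -h * Hω ω with hYω
  clear_value Yω
  set R : ℝ := h ^ 2 / 8 * (24 / s ^ 4) * Real.exp (s * (2 * m * B.card)) with hR
  clear_value R
  have hR0 : 0 ≤ R := by rw [hR]; positivity
  have hrem : ∀ ω, Yω ω ^ 2 / 2 * Real.exp (max (Yω ω) 0) ≤ R * Real.exp (t * Qω ω) := by
    intro ω
    have hz : 0 ≤ lam * Qω ω + 2 * m * B.card :=
      add_nonneg (mul_nonneg hlam (hQnn ω)) (mul_nonneg (mul_nonneg (by norm_num) hm0) (Nat.cast_nonneg _))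
    have hY2 : Yω ω ^ 2 ≤ h ^ 2 * ((lam * Qω ω + 2 * m * B.card) ^ 2 / 2) ^ 2 := by
      rw [hYω]
      have : (-h * Hω ω) ^ 2 = h ^ 2 * |Hω ω| ^ 2 := by rw [sq_abs]; ring
      rw [this]
      exact mul_le_mul_of_nonneg_left (pow_le_pow_left₀ (abs_nonneg _) (habs ω) 2) (sq_nonneg h)
    have h4 : ((lam * Qω ω + 2 * m * B.card) ^ 2 / 2) ^ 2 = (lam * Qω ω + 2 * m * B.card) ^ 4 / 4 := by ring
    have hpow := pow_four_le_mul_exp hz hspos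
    have hmax : Real.exp (max (Yω ω) 0) ≤ Real.exp (c * Qω ω) := by
      refine Real.exp_le_exp.2 (max_le ?_ (mul_nonneg hc0 (hQnn ω)))
      rw [hYω]; exact hdom ω
    have hexp0 : 0 ≤ Real.exp (max (Yω ω) 0) := (Real.exp_pos _).le
    calc Yω ω ^ 2 / 2 * Real.exp (max (Yω ω) 0)
        ≤ (h ^ 2 * ((lam * Qω ω + 2 * m * B.card) ^ 4 / 4)) / 2 * Real.exp (c * Qω ω) := by
          rw [← h4]
          exact mul_le_mul (by linarith) hmax hexp0 (by positivity)
      _ ≤ (h ^ 2 * ((24 / s ^ 4 * Real.exp (s * (lam * Qω ω + 2 * m * B.card))) / 4)) / 2 * Real.exp (c * Qω ω) := by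
          gcongr
      _ = R * Real.exp (t * Qω ω) := by
          have : s * (lam * Qω ω + 2 * m * B.card) = s * (2 * m * B.card) + s * lam * Qω ω := by ring
          rw [hR, ht, this, Real.exp_add, add_mul, Real.exp_add]
          ring
  -- (d) measurability / integrability on the uncurried side
  have hmeasH : Measurable Hω := by
    refine Continuous.measurable ?_
    rw [hHω]
    fun_prop
  have hmeasQ : Measurable Qω := by
    refine Continuous.measurable ?_
    rw [hQω]
    fun_prop
  have hmeasY : Measurable Yω := by rw [hYω]; exact hmeasH.const_mul (-h)
  have hintRem : Integrable (fun ω => Yω ω ^ 2 / 2 * Real.exp (max (Yω ω) 0)) (gaussianFieldOfKernel (curvatureCovKernel 4 D)) := by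
    refine (hintT.const_mul R).mono' ?_ (ae_of_all _ fun ω => ?_)
    · exact ((hmeasY.pow_const 2).div_const 2 |>.mul (Real.measurable_exp.comp (hmeasY.max measurable_const))).aestronglyMeasurable
    · rw [Real.norm_eq_abs, abs_of_nonneg (by positivity)]
      have h' := hrem ω
      simp only [hQω] at h'
      exact h'
  have hintExp : Integrable (fun ω => Real.exp (Yω ω)) (gaussianFieldOfKernel (curvatureCovKernel 4 D)) := by
    have hintc : Integrable (fun ω => Real.exp (c * ∑ u ∈ I, ω u ^ 2)) (gaussianFieldOfKernel (curvatureCovKernel 4 D)) :=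
      (integral_exp_mul_sum_sq_curvature_parallel_le hd D _ I hIor hc0 (hc8'.trans (by norm_num))).1
    refine hintc.mono' (Real.measurable_exp.comp hmeasY).aestronglyMeasurable (ae_of_all _ fun ω => ?_)
    rw [Real.norm_eq_abs, abs_of_pos (Real.exp_pos _)]
    have h' := hdom ω
    simp only [hQω] at h'
    rw [hYω]
    exact Real.exp_le_exp.2 h'
  -- `Y` is integrable: `|Y| ≤ h (λQ + 2m|B|)²/2 ≤ …` — simplest via continuity is not available on an infinite product, so
  -- dominate `|Y| ≤ 1 + Y²` by the remainder-type bound: use `|y| ≤ e^{y} + (y²/2) e^{max y 0} + 1`-free route: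
  -- `|Y| ≤ h |H| ≤ h (λ Q + 2 m |B|)^2 / 2 ≤ h (24 / s'^2 ...)`; we instead use `|y| ≤ 1 + y^2 ≤ 1 + 2·(y²/2)e^{max y 0}`.
  have hintY : Integrable Yω (gaussianFieldOfKernel (curvatureCovKernel 4 D)) := by
    refine ((integrable_const (1 : ℝ)).add (hintRem.const_mul 2)).mono' hmeasY.aestronglyMeasurable
      (ae_of_all _ fun ω => ?_)
    rw [Real.norm_eq_abs]
    show |Yω ω| ≤ 1 + 2 * (Yω ω ^ 2 / 2 * Real.exp (max (Yω ω) 0))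
    have h1 : |Yω ω| ≤ 1 + Yω ω ^ 2 := by
      rcases le_or_gt 1 |Yω ω| with hy | hy
      · calc |Yω ω| = |Yω ω| * 1 := (mul_one _).symm
          _ ≤ |Yω ω| * |Yω ω| := mul_le_mul_of_nonneg_left hy (abs_nonneg _)
          _ = Yω ω ^ 2 := by rw [← sq, sq_abs]
          _ ≤ 1 + Yω ω ^ 2 := le_add_of_nonneg_left zero_le_one
      · exact hy.le.trans (le_add_of_nonneg_right (sq_nonneg _))
    have h2 : Yω ω ^ 2 ≤ 2 * (Yω ω ^ 2 / 2 * Real.exp (max (Yω ω) 0)) := by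
      have he : 1 ≤ Real.exp (max (Yω ω) 0) := Real.one_le_exp (le_max_right _ _)
      calc Yω ω ^ 2 = 2 * (Yω ω ^ 2 / 2 * 1) := by ring
        _ ≤ 2 * (Yω ω ^ 2 / 2 * Real.exp (max (Yω ω) 0)) :=
            mul_le_mul_of_nonneg_left (mul_le_mul_of_nonneg_left he (by positivity)) (by norm_num)
    exact h1.trans (add_le_add_right h2 1)
  -- (e) the second-order bound on the uncurried side
  have hmain : Real.log (∫ ω, Real.exp (Yω ω) ∂gaussianFieldOfKernel (curvatureCovKernel 4 D)) ≤
      (∫ ω, Yω ω ∂gaussianFieldOfKernel (curvatureCovKernel 4 D)) + R * Real.exp (t * I.card) := by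
    have h1 := log_integral_exp_le (μ := gaussianFieldOfKernel (curvatureCovKernel 4 D)) Yω hintY hintExp hintRem
    have h2 : ∫ ω, Yω ω ^ 2 / 2 * Real.exp (max (Yω ω) 0) ∂gaussianFieldOfKernel (curvatureCovKernel 4 D) ≤
        R * Real.exp (t * I.card) := by
      calc ∫ ω, Yω ω ^ 2 / 2 * Real.exp (max (Yω ω) 0) ∂gaussianFieldOfKernel (curvatureCovKernel 4 D)
          ≤ ∫ ω, R * Real.exp (t * ∑ u ∈ I, ω u ^ 2) ∂gaussianFieldOfKernel (curvatureCovKernel 4 D) :=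
            integral_mono hintRem (hintT.const_mul R) fun ω => by
              have h' := hrem ω
              simp only [hQω] at h'
              exact h'
        _ = R * ∫ ω, Real.exp (t * ∑ u ∈ I, ω u ^ 2) ∂gaussianFieldOfKernel (curvatureCovKernel 4 D) := integral_const_mul _ _
        _ ≤ R * Real.exp (2 * t * (I.card * (2 / (4 : ℕ)))) := mul_le_mul_of_nonneg_left hleT hR0
        _ = R * Real.exp (t * I.card) := by congr 1; congr 1; push_cast; ring
    linarith
  -- (f) the constant: `R · e^{t|I|} ≤ K h² N⁴`
  have hslN : s * lam * N ≤ 1 / 8 := by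
    have := hsl
    rw [le_div_iff₀ hNpos] at this
    exact this
  have hcBN : (B.card : ℝ) ≤ N := by rw [hN]; exact le_add_of_nonneg_right zero_le_one
  have hconst : R * Real.exp (t * I.card) ≤ K * h ^ 2 * N ^ 4 := by
    rw [hR, hKdef]
    exact window_const_bound hN1 hs hs₀pos hm0 ht ht0 hslN hc8 hcardI hcBN (Nat.cast_nonneg _)
  -- (g) transport to the curvature field (currying) and the exact first cumulant
  have hcomp : ((fun Y : ZdPlaquette 4 → Fin D → ℝ => Real.exp (-h * ∑ x ∈ B,
          (lam / 2 * (∑ a : Fin D, (Y (p x)) a ^ 2) - m) * (lam / 2 * (∑ a : Fin D, (Y (q x)) a ^ 2) - m))) ∘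
        ⇑(MeasurableEquiv.curry (ZdPlaquette 4) (Fin D) ℝ)) = fun ω => Real.exp (Yω ω) := by
    funext ω
    simp only [Function.comp_apply, MeasurableEquiv.coe_curry, Function.curry_apply, hYω, hHω]
  have hcompY : ((fun Y : ZdPlaquette 4 → Fin D → ℝ => -h * ∑ x ∈ B,
          (lam / 2 * (∑ a : Fin D, (Y (p x)) a ^ 2) - m) * (lam / 2 * (∑ a : Fin D, (Y (q x)) a ^ 2) - m)) ∘
        ⇑(MeasurableEquiv.curry (ZdPlaquette 4) (Fin D) ℝ)) = fun ω => Yω ω := by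
    funext ω
    simp only [Function.comp_apply, MeasurableEquiv.coe_curry, Function.curry_apply, hYω, hHω]
  have hintegral_exp : ∫ Y, Real.exp (-h * ∑ x ∈ B,
      (lam / 2 * (∑ a : Fin D, (Y (p x)) a ^ 2) - m) * (lam / 2 * (∑ a : Fin D, (Y (q x)) a ^ 2) - m))
      ∂curvatureGaussianField (d := 4) D = ∫ ω, Real.exp (Yω ω) ∂gaussianFieldOfKernel (curvatureCovKernel 4 D) := by
    rw [curvatureGaussianField, integral_map_equiv]
    exact integral_congr_ae (ae_of_all _ fun ω => congrFun hcomp ω)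
  have hintegral_Y : ∫ Y, -h * ∑ x ∈ B,
      (lam / 2 * (∑ a : Fin D, (Y (p x)) a ^ 2) - m) * (lam / 2 * (∑ a : Fin D, (Y (q x)) a ^ 2) - m)
      ∂curvatureGaussianField (d := 4) D = ∫ ω, Yω ω ∂gaussianFieldOfKernel (curvatureCovKernel 4 D) := by
    rw [curvatureGaussianField, integral_map_equiv]
    exact integral_congr_ae (ae_of_all _ fun ω => congrFun hcompY ω)
  have hfirst : ∫ Y, -h * ∑ x ∈ B,
      (lam / 2 * (∑ a : Fin D, (Y (p x)) a ^ 2) - m) * (lam / 2 * (∑ a : Fin D, (Y (q x)) a ^ 2) - m)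
      ∂curvatureGaussianField (d := 4) D =
      -h * ((B.card : ℝ) * (lam ^ 2 * D / 2 * (curvaturePlaquetteCorr (d := 4) hd (n : ℤ)) ^ 2)) := by
    rw [integral_const_mul]
    exact congrArg (fun z => -h * z) hfcn
  rw [hintegral_exp]
  rw [← hintegral_Y, hfirst] at hmain
  have hN4 : K * h ^ 2 * N ^ 4 = K * h ^ 2 * ((B.card : ℝ) + 1) ^ 4 := by rw [hN]
  linarith [hmain, hconst]

end Window

end Summit.QuantumFields.YangMills.Cruxes.SourcedPressureIncrement.Birth

end
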